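import Mathlib
import Summits.QuantumFields.BalabanUV.T4Continuum.Support.SliceFlatReadings
import Summits.QuantumFields.BalabanUV.T4Continuum.Support.SliceFlatGradient

/-!
# T⁴ programme, node NE3 (η-rate of the minimisers) — THE FLAT RUNG, part 14: the lineage's ONE TYPE INSTANTIATED AT THE FLAT
# DATA — every STABILITY hypothesis discharged; what remains at `U = 1` are the CONSISTENCY readings only

Fifteenth generation of the NE3 prover lineage P1 of the cell `pub-balaban`, file 8 (bookkeeping; no new estimate).  The one type
`SliceCovariantLevels.ne3Shape_torusCovE_upto_of_printedStatements` (p199789) = NE3's typed skeleton: STABILITY hypotheses (`hRm`,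
`hblk`, `ham`, `hbd`, the three printed-statement bundles `hT31` ∕ `hT349` ∕ `hT311` over `LevIdx`, the identifications `hA0` ∕ `hA1` ∕
`hF3`) + CONSISTENCY hypotheses (the located readings `hdl h1 h3 h4 h5 ht hosc hact hvol hread hresp hpair`, unprinted) ⟹ `NE3Shape`.
The flat rung of generations 13–15 made every stability hypothesis a THEOREM at Bałaban's `U = 1` data (`E := flatE`, `Kc := cubeComb`,
`Rm := flatRm`, `am := flatAm`, `Ng := flatNg`, `G_j = gFlat j`, site distance `nbd`): `gFlat_rowBound` (g13), `stmt349Printed_flat` ∕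
`thm311Printed_flat` (g14, p201832), `thm31Printed_flat` (g15, part 13, with `D := colDiff ν`).  THIS FILE plugs them in:
 * **`ne3Shape_flat_of_consistencyReadings`** — for every index type `ι`, readings carrier `R`, direction `ν`, and `M, c35`: IF the
   consistency readings of the one type hold for the flat tower with `D k V := colDiff ν` (in particular `hdl`: the located datum
   `dl k V` is dominated by a row of `gFlat k·colDiff ν` over the unit-face skeleton), THEN the one type's conclusion holds —
   `∃ M₁ a₀ > 0, (M₁ ≤ M → ∀ α₀ > 0, M·α₀ ≤ a₀ → ∃ C′, NE3Shape R C′ (L^{−a}))` — with NO stability hypothesis and NO regularity-class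
   hypothesis left (backgrounds bundle `unitBg`, whose class (3.35) is `True`: at `U = 1` the flat bounds hold for every configuration).
HONEST: (i) the printed thresholds `M₁ ≤ M`, `Mα₀ ≤ a₀` survive in the conclusion as the (here vacuous-in-content but opaque)
existential of the typed `B9.Thm31Printed` ∕ `Stmt349Printed` ∕ `Thm311Printed` shapes — the flat witnesses are `M₁ = a₀ = 1`, but the one
type returns them existentially; (ii) `U = 1` ONLY — at `U ≠ 1` the stability readings are [B9] Thms 3.1∕3.3∕(3.49)∕3.11 BY NAME (wall
(W1)); (iii) the consistency readings (wall (W2): the face-transmission structure of `U_{k+1}(V)`, unprinted) are untouched and are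
now, at the flat data, EXACTLY what separates the skeleton from `NE3Shape`.  NE3 is NOT proved.

Honest framing: finite-T⁴ ultraviolet bookkeeping about MINIMISERS (rung (B)+1 of the cell's ladder); no conditional of the cell
(`BetaPertH`, (B), (B^μ)) is used or hidden; nothing bears on infinite volume, a mass gap, or the Clay problem.  ABSOLUTE RULE of
the cell kept: inputs are kernel-proved tree modules only; no `def … : Prop`, no `sorry`, no axioms beyond Mathlib's.  PLACEMENT
(human rule 2026-08-19): cell work under `Summits/QuantumFields/BalabanUV/`; moves nothing.  Records: `t4/T4-EST-U1b-OSC.md` v1.32,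
`t4/T4-EST-NE3-P1.md` v2.31, GAPS G-ne3p1-45 of the cell `pub-balaban`.
-/

noncomputable section

open Real Finset Matrix

namespace Summit.QuantumFields.BalabanUV.T4Continuum.SliceFlatSkeleton

open Literature.MathematicalPhysics.QuantumFieldTheory.Balaban1983to89
open Literature.MathematicalPhysics.QuantumFieldTheory.Balaban1983to89.TreeLengthTorus (TPt)
open Literature.MathematicalPhysics.QuantumFieldTheory.Balaban1983to89.T4EtaRateMin (Readings NE3Shape)
open Literature.MathematicalPhysics.QuantumFieldTheory.Balaban1983to89.T4FixedPointResponse (OneStepCorrectionRate)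
open Summit.QuantumFields.BalabanUV.T4Continuum
open SliceTorusBlocks SliceTorusBlockModel SliceTorusTower SliceCovariantModel SliceCovariantTower SliceCovariantSkeleton
open SliceCovariantPrincipal SliceCovariantLevels SliceTorusComb SliceTorusSkeleton SliceFlatPropagator SliceFlatOperators
open SliceFlatReadings SliceFlatFreeResolvent SliceFlatGradientPrep SliceFlatGradient

/-- **NE3's ONE TYPE AT THE FLAT DATA: the conclusion follows from the CONSISTENCY readings alone.**  All structural and stability
hypotheses of `SliceCovariantLevels.ne3Shape_torusCovE_upto_of_printedStatements` are discharged by the flat rung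
(`flatRm_isometric`, `cubeComb_blk`, `flatAm = 1`, `hbd` by `rfl`, `thm31Printed_flat`, `stmt349Printed_flat`, `thm311Printed_flat`,
`flatA_zero`, `flatA_one`, `flatFk_three`) with backgrounds `unitBg` (regularity class `True`) and `D k V := colDiff ν`; the located
reading `hdl` is stated on a row of `gFlat k·colDiff ν` over the unit-face skeleton.  HONEST: thresholds survive existentially; `U = 1`
only; NE3 is NOT proved. [folklore] -/
theorem ne3Shape_flat_of_consistencyReadings {ι : Type} {Xr : Type*} [Fintype Xr] {R : Readings ι Xr}
    (d N L : ℕ) [NeZero N] [NeZero L] (M c35 : ℝ) (ν : Fin (d + 1))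
    {z dl sig blk lam t osc nrm pair : ℕ → ι → ℝ} {CJ CB B CPo CD B0 CR Γ Λr ρ₂ a : ℝ}
    (hL : 2 ≤ L) (ha0 : 0 < a) (ha : a < 1) (hd : 1 ≤ d)
    -- CONSISTENCY: the located readings (unprinted), `hdl` on a row of `gFlat k · colDiff ν` over the face skeleton
    (hdl : ∀ k, ∀ V ∈ R.dom, ∃ x : TPt (d + 1) (N * L ^ k) × Fin (d + 1),
      dl k V ≤ ∑ y ∈ faceSkelI (d + 1) k N L (Fin (d + 1)), |(gFlat d k N L k * colDiff d k N L ν) x y|)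
    (h1 : ∀ k : ℕ, ∀ V ∈ R.dom, z k V ≤ dl k V * sig k V + blk k V)
    (h3 : ∀ k : ℕ, ∀ V ∈ R.dom, 0 ≤ sig k V ∧ sig k V ≤ CJ * lam k V)
    (h4 : ∀ k : ℕ, ∀ V ∈ R.dom, 0 ≤ blk k V ∧ blk k V ≤ CB * (1 + k * Real.log L) * lam k V)
    (h5 : ∀ k : ℕ, ∀ V ∈ R.dom, 0 ≤ lam k V ∧ lam k V ≤ B * ((L : ℝ)⁻¹ ^ k) ^ 3)
    (hCJ : 0 ≤ CJ) (hCB : 0 ≤ CB) (hCPo : 0 ≤ CPo) (hCD : 0 ≤ CD) (hB : 0 ≤ B) (hB0 : 0 ≤ B0) (hCR : 0 ≤ CR)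
    (hΓ : 0 ≤ Γ) (hΛr : 0 ≤ Λr) (hρ₂ : 0 ≤ ρ₂)
    (ht : ∀ k : ℕ, ∀ V ∈ R.dom, t k V ≤ B0 * CR * (L : ℝ)⁻¹ ^ k)
    (hosc : ∀ k : ℕ, ∀ V ∈ R.dom, osc k V ≤ (1 + CD) * (1 + CPo) * z k V / ((L : ℝ)⁻¹ ^ k) ^ 2 + t k V)
    (hact : ∀ k : ℕ, ∀ V ∈ R.dom, R.act k V = ∑ x, R.loc k V x) (hvol : (Fintype.card Xr : ℝ) ≤ R.vol)
    (hread : ∀ k : ℕ, ∀ V ∈ R.dom, ∀ x : Xr, |R.loc (k + 1) V x - R.loc k V x| ≤ Λr * nrm k V + pair k V)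
    (hresp : ∀ k : ℕ, ∀ V ∈ R.dom, nrm k V ≤ Γ * osc k V)
    (hpair : OneStepCorrectionRate R.dom pair ρ₂ ((L : ℝ) ^ (-a))) :
    ∃ M₁ a₀ : ℝ, 0 < M₁ ∧ 0 < a₀ ∧
      (M₁ ≤ M → ∀ α₀ : ℝ, 0 < α₀ → M * α₀ ≤ a₀ → ∃ C' : ℝ, NE3Shape R C' ((L : ℝ) ^ (-a))) := by
  have hd2 : 2 ≤ d + 1 := by omega
  -- `hdl` for `gLevE` at the flat data
  have hdl' : ∀ k, ∀ V ∈ R.dom, ∃ x : TPt (d + 1) (N * L ^ k) × Fin (d + 1),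
      dl k V ≤ ∑ y ∈ faceSkelI (d + 1) k N L (Fin (d + 1)),
        |(gLevE (flatE d k N L) (cubeComb (d + 1) k N L) (flatRm d k N L) (wB L (d + 1)) (aB L (d + 1) flatAm) (flatNg d k N L) k
          * colDiff d k N L ν) x y| := by
    intro k V hV; rw [gLevE_flat]; exact hdl k V hV
  obtain ⟨M₁, a₀, hM₁, ha₀, h⟩ := ne3Shape_torusCovE_upto_of_printedStatements (d := d + 1) (N := N) (L := L) (Cp := Fin (d + 1))
    (Bd := fun k => TBond (d + 1) (N * L ^ k)) (R := R) M c35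
    (fun _ _ _ => unitBg) (fun _ _ _ => PUnit.unit)
    (fun k j y y₁ => (nbd (d + 1) k N L j y y₁ : ℝ))
    (fun k _ j => flatA d k N L ν j (B := unitBg)) (fun k _ j => flatFk d k N L j (B := unitBg))
    (fun k _ => flatE d k N L) (fun k => bsrcT (d + 1) (N * L ^ k)) (fun k => btgtT (d + 1) (N * L ^ k))
    (fun k _ j => cubeComb (d + 1) k N L j) (fun k _ => flatRm d k N L) (fun _ _ => flatAm)
    (fun k _ => flatNg d k N L) (fun k _ => colDiff d k N L ν) (amax := 1)
    hL ha0 ha hd2 zero_le_one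
    (fun k _ b i j => flatRm_isometric d k N L b i j) (fun k _ j x => cubeComb_blk (d + 1) k N L j x)
    (fun _ _ _ => ⟨zero_le_one, le_rfl⟩) (fun _ _ _ _ => le_rfl)
    (thm31Printed_flat d N L c35 M (fun _ _ _ => unitBg) ν) (stmt349Printed_flat d N L c35 M (fun _ _ _ => unitBg))
    (thm311Printed_flat d N L c35 _ (fun _ _ _ => unitBg))
    (fun k _ j => flatA_zero d k N L ν j (B := unitBg) PUnit.unit) (fun k _ j => flatA_one d k N L ν j (B := unitBg) PUnit.unit)
    (fun k _ j => flatFk_three d k N L j (B := unitBg) PUnit.unit)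
    hdl' h1 h3 h4 h5 hCJ hCB hCPo hCD hB hB0 hCR hΓ hΛr hρ₂ ht hosc hact hvol hread hresp hpair
  exact ⟨M₁, a₀, hM₁, ha₀, fun hM α₀ hα₀ hMa => h hM α₀ hα₀ hMa fun _ _ _ _ _ => trivial⟩

end Summit.QuantumFields.BalabanUV.T4Continuum.SliceFlatSkeleton
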